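import Literature.AnabelianGeometry.AbsoluteAnabelian.AbsTopI.RelativeGCInstances
import Literature.AnabelianGeometry.AbsoluteAnabelian.SubpadicIsGeneralizedSubpadic
import HarnessLib

/-!
# [AbsTopI] Example 4.8 (i): `Ex_4_8_i` — CLOSED INSTANCE FORMS at the tautological-GC classes
# (FACT-LIST row F-0193)

S. Mochizuki, *Topics in Absolute Anabelian Geometry I: Generalities* (2012) [MochizukiAbsTopI2012], §4,
Example 4.8 (i) p. 58: "`p` a prime number; `𝕊` the set of subsets of Primes containing `p`; `𝕍` the set
of isomorphism classes of hyperbolic orbicurves [...]. (i) Let `𝔽` be the set of isomorphism classes of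
generalized sub-`p`-adic fields. Then [...] the hypotheses of Theorem 4.7, (i), (ii), are satisfied
relative to this `𝒟`.  Indeed, it is immediate that `𝒟` is chain-full; the rel-isom-DGC follows from
[Mzk5], Theorem 4.12; the prime `p` clearly serves as a prime “`l`” as in the statement of Theorem 4.7.
Moreover, we recall from [Mzk5], Lemma 4.14, that the absolute Galois group of a generalized sub-`p`-adic
field is always slim."

PROOF-ONLY companion (theorems only: no `def`, no `instance`, no `structure`, no notation) of
`AbsTopI/RelativeGC.lean` (abc-iut-L4-t13; the named fact `ConstructionDataClass.Ex_4_8_i`, typed with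
FOUR clauses: chain-full ∧ rel-isom-DGC ∧ `χ_p` open image ∧ `G_{k_b}` slim) and of
`AbsTopI/RelativeGCInstances.lean` (abc-iut-f-057, KEY row INST59H1: closed instance forms of `RelHomDGC`
/ `RelIsomDGC` / `Ex_4_8_ii` at the tautological-GC classes over `ℚ`).  abc-iut cell, block F, seat
abc-iut-f-193 (gen 20), KEY row INST59H1b: the LF kernel census sees for F-0193 only the `∀`-closure
refuter `not_forall_ex_4_8_i` (abc-iut-f-056), conditional closers (`ex_4_8_i_of`,
`ex_4_8_i_of_relIsomDGC'`, `ex_4_8_i_of_thm_4_12'`, …) and `∃`-packaged model witnesses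
(`exists_isEx48Class_point_model`, `exists_splitTautological_ex_4_8_reclosed`) — no theorem whose
conclusion HEAD is literally `Ex_4_8_i 𝒟 p` at a class `𝒟` written out as a term.  This file supplies
such theorems, with 0 `Prop` hypotheses:

* `ex_4_8_i_tautologicalClass_field`: for EVERY prime `p`, EVERY field `k` of characteristic zero and
  EVERY family `Π : ι → (Π_X ↠ G_k)` of augmented profinite groups over `G_k = Gal(k̄/k)`, the one-field
  tautological-GC class over `k` (objects `ι`; "scheme-theoretic" morphisms `X → Y` DEFINED to be the
  open outer homomorphisms `Π X → Π Y` over `G_k`, "isomorphisms" those whose class is an outer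
  isomorphism, "the natural map `f ↦ [π₁(f)]`" the inclusion; every object a member and a hyperbolic
  orbicurve, `Σ = Primes`, all pairs chain terms) satisfies `Ex_4_8_i · p`.  The two FIELD-SIDE clauses
  are the cell's kernel theorems for generalized sub-`p`-adic fields, packaged in abc-iut-L4-t13's
  `ex_4_8_i_of_relIsomDGC'` ("`p` serves as `l`": `cyclotomic_of_isEx48ClassGen`; [Tpcs] Lem 4.14:
  `Tpcs.lem_4_14_slim_holds` via `slim_of_isEx48ClassGen`); chain-fullness is immediate and the
  rel-isom-DGC holds by construction (an outer isomorphism is open, `OuterHom.IsIso.isOpen`).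
* NON-VACUITY: the typed HYPOTHESIS `IsEx48ClassGen p` of that implication HOLDS whenever `k` is
  generalized sub-`p`-adic (`isEx48ClassGen_tautologicalClass_field`), in particular over `k = ℚ`
  (`isEx48ClassGen_tautologicalClass`: number fields are sub-`p`-adic, [pGC] Def 15.4 (i) example (2),
  `AbsTopIII.IsSubpadicFor.of_numberField`; sub-`p`-adic ⇒ generalized sub-`p`-adic, [Tpcs] remark after
  Def 4.11, `AbsTopIII.IsSubpadicFor.isGeneralizedSubpadicFor` — both tree theorems).
* `ex_4_8_i_tautologicalClass`: the HEAD form at abc-iut-f-057's class over `ℚ` (the term of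
  `relIsomDGC_tautologicalClass` / `ex_4_8_ii_tautologicalClass` verbatim), for every `ι`, `Π`.
* the closed specialisation `Π = G_ℚ × G_ℚ ↠ G_ℚ` (second projection; `Δ = G_ℚ × 1 ≅ G_ℚ`, a
  non-trivial geometric part; one object), 0 binders: `isEx48ClassGen_prodClass_two`,
  `ex_4_8_i_prodClass_two` (`p = 2`).

HONEST LABEL: TAUTOLOGICAL carrier — the scheme side is DEFINED as the group side, so the rel-isom-DGC
of Def 4.6 (ii) holds by construction; the content of [Tpcs] Thm 4.12 (that the `k`-isomorphisms of
actual hyperbolic orbicurves are exactly the outer isomorphisms of their étale `π₁` over `G_k`) is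
precisely what is NOT modelled (the étale `π₁` of a curve is not constructible in the tree, abc-iut
FOUNDATIONS row 12).  An instance form about OUR typed interface — exactly the instances the closure
refuter's chain-term junk spares; instantiated ≠ endorsed; typed ≠ proved; nothing here bears on
[IUTchIII] Cor. 3.12 or takes a side; nothing asserts abc proved or refuted.  Axioms standard.
-/

namespace Literature.AnabelianGeometry.AbsoluteAnabelian.AbsTopI.ConstructionDataClass

open AugmentedProfiniteGrp

/-! ### The tautological-GC class over an arbitrary field `k` of characteristic zero -/

/-- **F-0193, CLOSED INSTANCE FORM over any base field** ([AbsTopI] Example 4.8 (i) as typed,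
`Ex_4_8_i 𝒟 p`): for every prime `p`, every field `k` of characteristic zero and every family
`Π : ι → (Π_X ↠ G_k)`, the one-field tautological-GC class over `k` (morphisms := open outer homomorphisms
over `G_k`, isomorphisms := those that are outer isomorphisms, natural map := inclusion; all objects
members and hyperbolic orbicurves, `Σ = Primes`, all pairs chain terms) satisfies `Ex_4_8_i · p`: GIVEN
that it is an Example-4.8 (i) class (`IsEx48ClassGen p`, i.e. `k` generalized sub-`p`-adic), it is
chain-full (every chain term is a member with the same `Σ`), satisfies the rel-isom-DGC (tautologically:
an outer isomorphism over `G_k` is open, hence a morphism of the class, flagged iso), "`p` serves as the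
prime `l`" (`χ_p : G_k → ℤ_p^×` has open image — `cyclotomic_of_isEx48ClassGen`) and `G_k` is slim
([Tpcs] Lem 4.14 — `Tpcs.lem_4_14_slim_holds`), the last two packaged in `ex_4_8_i_of_relIsomDGC'`.
0 `Prop` hypotheses; TAUTOLOGICAL model, nothing about curves. [cite: MochizukiAbsTopI2012, Ex 4.8 (i) p.58] -/
theorem ex_4_8_i_tautologicalClass_field (p : ℕ) [Fact p.Prime] (k : Type) [Field k] [CharZero k]
    (ι : Type) (A : ι → AugmentedProfiniteGrp (absoluteGaloisGrp k)) :
    Literature.AnabelianGeometry.AbsoluteAnabelian.AbsTopI.ConstructionDataClass.Ex_4_8_i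
      ({ Base := Unit
         fld := fun _ => k
         instField := fun _ => inferInstance
         instCharZero := fun _ => inferInstance
         datum := fun _ =>
           { Obj := ι
             Hom := fun X Y => {c : (A X).OuterHom (A Y) // c.IsOpen}
             IsIso := fun f => f.1.IsIso
             IsHyperbolicCurve := fun _ => True
             primes := Set.univ
             grp := A
             outerHom := fun f => f.1 }
         Mem := fun _ _ => True
         IsHyperbolicOrbicurve := fun _ _ => True
         isHyperbolicOrbicurve_of_isHyperbolicCurve := fun _ _ _ => trivial
         chainTerms := fun _ _ => Set.univ } : ConstructionDataClass.{0}) p :=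
  ex_4_8_i_of_relIsomDGC' (fun _ _ _ _ _ => ⟨trivial, rfl⟩)
    (fun _ _ _ _ _ =>
      ⟨fun _ hf => hf, fun _ _ _ _ h => Subtype.ext h,
        fun c hc => ⟨⟨c, OuterHom.IsIso.isOpen hc⟩, hc, rfl⟩⟩)

/-- **NON-VACUITY over a generalized sub-`p`-adic field**: if `k` is generalized sub-`p`-adic
(`AbsTopIII.IsGeneralizedSubpadicFor k p`, [Tpcs] Def 4.11), the tautological-GC class over `k` IS an
Example-4.8 (i) class in the typed sense `IsEx48ClassGen p` — its one field is generalized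
sub-`p`-adic, `p ∈ Σ = Primes`, and the members are exactly the objects flagged hyperbolic orbicurves
(all of them) — so the implication `ex_4_8_i_tautologicalClass_field` fires there.
[cite: MochizukiAbsTopI2012, Ex 4.8 (i) p.58] -/
theorem isEx48ClassGen_tautologicalClass_field (p : ℕ) [Fact p.Prime] (k : Type) [Field k] [CharZero k]
    (hk : AbsTopIII.IsGeneralizedSubpadicFor k p)
    (ι : Type) (A : ι → AugmentedProfiniteGrp (absoluteGaloisGrp k)) :
    Literature.AnabelianGeometry.AbsoluteAnabelian.AbsTopI.ConstructionDataClass.IsEx48ClassGen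
      ({ Base := Unit
         fld := fun _ => k
         instField := fun _ => inferInstance
         instCharZero := fun _ => inferInstance
         datum := fun _ =>
           { Obj := ι
             Hom := fun X Y => {c : (A X).OuterHom (A Y) // c.IsOpen}
             IsIso := fun f => f.1.IsIso
             IsHyperbolicCurve := fun _ => True
             primes := Set.univ
             grp := A
             outerHom := fun f => f.1 }
         Mem := fun _ _ => True
         IsHyperbolicOrbicurve := fun _ _ => True
         isHyperbolicOrbicurve_of_isHyperbolicCurve := fun _ _ _ => trivial
         chainTerms := fun _ _ => Set.univ } : ConstructionDataClass.{0}) p :=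
  ⟨fun _ => hk, fun _ => Set.mem_univ p, fun _ _ => Iff.rfl⟩

/-- Hence, over a generalized sub-`p`-adic field `k`, the tautological-GC class satisfies the FOUR typed
clauses of Example 4.8 (i) OUTRIGHT (hypothesis discharged): chain-full, rel-isom-DGC, `χ_p` open image
on `G_k`, `G_k` slim. [cite: MochizukiAbsTopI2012, Ex 4.8 (i) p.58] -/
theorem ex_4_8_i_clauses_tautologicalClass_field (p : ℕ) [Fact p.Prime] (k : Type) [Field k]
    [CharZero k] (hk : AbsTopIII.IsGeneralizedSubpadicFor k p)
    (ι : Type) (A : ι → AugmentedProfiniteGrp (absoluteGaloisGrp k)) :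
    let 𝒟 : ConstructionDataClass.{0} :=
      { Base := Unit
        fld := fun _ => k
        instField := fun _ => inferInstance
        instCharZero := fun _ => inferInstance
        datum := fun _ =>
          { Obj := ι
            Hom := fun X Y => {c : (A X).OuterHom (A Y) // c.IsOpen}
            IsIso := fun f => f.1.IsIso
            IsHyperbolicCurve := fun _ => True
            primes := Set.univ
            grp := A
            outerHom := fun f => f.1 }
        Mem := fun _ _ => True
        IsHyperbolicOrbicurve := fun _ _ => True
        isHyperbolicOrbicurve_of_isHyperbolicCurve := fun _ _ _ => trivial
        chainTerms := fun _ _ => Set.univ }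
    𝒟.IsChainFull ∧ 𝒟.RelIsomDGC ∧
      (∀ b, IsOpen (Set.range (AbsTopIII.cyclotomicChar (𝒟.fld b) p))) ∧
      ∀ b, Literature.AlgebraicGeometry.Frobenioids.IsSlimGroup (Field.absoluteGaloisGroup (𝒟.fld b)) :=
  ex_4_8_i_tautologicalClass_field p k ι A (isEx48ClassGen_tautologicalClass_field p k hk ι A)

/-! ### The tautological-GC class over `ℚ` (abc-iut-f-057's term, `RelativeGCInstances.lean`) -/

/-- **The typed HYPOTHESIS of [AbsTopI] Example 4.8 (i) HOLDS at the tautological-GC class over `ℚ`**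
(so the instance `ex_4_8_i_tautologicalClass` below is NOT vacuous): the class IS an Example-4.8 (i)
class in the typed sense `IsEx48ClassGen p` — its one field `ℚ` is generalized sub-`p`-adic for every
prime `p` (number fields are sub-`p`-adic, [pGC] Def 15.4 (i) example (2),
`AbsTopIII.IsSubpadicFor.of_numberField`; sub-`p`-adic ⇒ generalized sub-`p`-adic, [Tpcs] remark after
Def 4.11 p. 44, `AbsTopIII.IsSubpadicFor.isGeneralizedSubpadicFor`), `p ∈ Σ = Primes`, and the members
are exactly the objects flagged hyperbolic orbicurves. [cite: MochizukiAbsTopI2012, Ex 4.8 (i) p.58] -/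
theorem isEx48ClassGen_tautologicalClass (p : ℕ) [Fact p.Prime] (ι : Type)
    (A : ι → AugmentedProfiniteGrp (absoluteGaloisGrp ℚ)) :
    Literature.AnabelianGeometry.AbsoluteAnabelian.AbsTopI.ConstructionDataClass.IsEx48ClassGen
      ({ Base := Unit
         fld := fun _ => ℚ
         instField := fun _ => inferInstance
         instCharZero := fun _ => inferInstance
         datum := fun _ =>
           { Obj := ι
             Hom := fun X Y => {c : (A X).OuterHom (A Y) // c.IsOpen}
             IsIso := fun f => f.1.IsIso
             IsHyperbolicCurve := fun _ => True
             primes := Set.univ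
             grp := A
             outerHom := fun f => f.1 }
         Mem := fun _ _ => True
         IsHyperbolicOrbicurve := fun _ _ => True
         isHyperbolicOrbicurve_of_isHyperbolicCurve := fun _ _ _ => trivial
         chainTerms := fun _ _ => Set.univ } : ConstructionDataClass.{0}) p :=
  isEx48ClassGen_tautologicalClass_field p ℚ
    (AbsTopIII.IsSubpadicFor.of_numberField ℚ p).isGeneralizedSubpadicFor ι A

/-- **F-0193, CLOSED INSTANCE FORM** ([AbsTopI] Example 4.8 (i) as typed, `Ex_4_8_i 𝒟 p`): for every
prime `p` and every family `Π : ι → (Π_X ↠ G_ℚ)`, abc-iut-f-057's tautological-GC class over `ℚ` (the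
class of `relIsomDGC_tautologicalClass` / `ex_4_8_ii_tautologicalClass`, verbatim) satisfies
`Ex_4_8_i · p` — NON-VACUOUSLY, its hypothesis `IsEx48ClassGen p` holding
(`isEx48ClassGen_tautologicalClass`): chain-full, rel-isom-DGC (F-0197 instance
`relIsomDGC_tautologicalClass`), "`p` serves as the prime `l`" (`χ_p` on `G_ℚ` has open image) and
`G_ℚ` slim ([Tpcs] Lem 4.14), the two field-side clauses being the cell's kernel theorems packaged in
`ex_4_8_i_of_relIsomDGC'`.  TAUTOLOGICAL model (the 'GC' clause holds by construction); nothing about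
curves. [cite: MochizukiAbsTopI2012, Ex 4.8 (i) p.58] -/
theorem ex_4_8_i_tautologicalClass (p : ℕ) [Fact p.Prime] (ι : Type)
    (A : ι → AugmentedProfiniteGrp (absoluteGaloisGrp ℚ)) :
    Literature.AnabelianGeometry.AbsoluteAnabelian.AbsTopI.ConstructionDataClass.Ex_4_8_i
      ({ Base := Unit
         fld := fun _ => ℚ
         instField := fun _ => inferInstance
         instCharZero := fun _ => inferInstance
         datum := fun _ =>
           { Obj := ι
             Hom := fun X Y => {c : (A X).OuterHom (A Y) // c.IsOpen}
             IsIso := fun f => f.1.IsIso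
             IsHyperbolicCurve := fun _ => True
             primes := Set.univ
             grp := A
             outerHom := fun f => f.1 }
         Mem := fun _ _ => True
         IsHyperbolicOrbicurve := fun _ _ => True
         isHyperbolicOrbicurve_of_isHyperbolicCurve := fun _ _ _ => trivial
         chainTerms := fun _ _ => Set.univ } : ConstructionDataClass.{0}) p :=
  ex_4_8_i_of_relIsomDGC' (fun _ _ _ _ _ => ⟨trivial, rfl⟩) (relIsomDGC_tautologicalClass ι A)

/-! ### Closed specialisation: one object with `Π = G_ℚ × G_ℚ ↠ G_ℚ` (`Δ ≅ G_ℚ ≠ 1`), 0 binders -/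

/-- **Non-vacuity at a 0-binder term** (`p = 2`): the tautological-GC class over `ℚ` with ONE object
whose augmented profinite group is `G_ℚ × G_ℚ ↠ G_ℚ` (second projection; geometric part
`Δ = G_ℚ × 1`, non-trivial) IS an Example-4.8 (i) class for `p = 2` (`ℚ` is generalized sub-`2`-adic).
[cite: MochizukiAbsTopI2012, Ex 4.8 (i) p.58] -/
theorem isEx48ClassGen_prodClass_two :
    Literature.AnabelianGeometry.AbsoluteAnabelian.AbsTopI.ConstructionDataClass.IsEx48ClassGen
      ({ Base := Unit
         fld := fun _ => ℚ
         instField := fun _ => inferInstance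
         instCharZero := fun _ => inferInstance
         datum := fun _ =>
           { Obj := Unit
             Hom := fun _ _ =>
               {c : AugmentedProfiniteGrp.OuterHom (G := absoluteGaloisGrp ℚ)
                   { arith := ProfiniteGrp.of (Field.absoluteGaloisGroup ℚ × Field.absoluteGaloisGroup ℚ)
                     aug := ContinuousMonoidHom.snd _ _
                     aug_surjective := fun y => ⟨(1, y), rfl⟩ }
                   { arith := ProfiniteGrp.of (Field.absoluteGaloisGroup ℚ × Field.absoluteGaloisGroup ℚ)
                     aug := ContinuousMonoidHom.snd _ _
                     aug_surjective := fun y => ⟨(1, y), rfl⟩ } // c.IsOpen}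
             IsIso := fun f => f.1.IsIso
             IsHyperbolicCurve := fun _ => True
             primes := Set.univ
             grp := fun _ =>
               { arith := ProfiniteGrp.of (Field.absoluteGaloisGroup ℚ × Field.absoluteGaloisGroup ℚ)
                 aug := ContinuousMonoidHom.snd _ _
                 aug_surjective := fun y => ⟨(1, y), rfl⟩ }
             outerHom := fun f => f.1 }
         Mem := fun _ _ => True
         IsHyperbolicOrbicurve := fun _ _ => True
         isHyperbolicOrbicurve_of_isHyperbolicCurve := fun _ _ _ => trivial
         chainTerms := fun _ _ => Set.univ } : ConstructionDataClass.{0}) 2 :=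
  isEx48ClassGen_tautologicalClass 2 Unit fun _ =>
    { arith := ProfiniteGrp.of (Field.absoluteGaloisGroup ℚ × Field.absoluteGaloisGroup ℚ)
      aug := ContinuousMonoidHom.snd _ _
      aug_surjective := fun y => ⟨(1, y), rfl⟩ }

/-- **F-0193 at a 0-binder term** (`p = 2`): the one-object tautological-GC class over `ℚ` with
`Π = G_ℚ × G_ℚ ↠ G_ℚ` (base field `ℚ`, generalized sub-`2`-adic, so the hypothesis `IsEx48ClassGen 2`
HOLDS — `isEx48ClassGen_prodClass_two`) satisfies `Ex_4_8_i · 2`: chain-full, rel-isom-DGC (F-0197 at the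
same term: `relIsomDGC_prodClass`), `χ_2 : G_ℚ → ℤ_2^×` with open image, `G_ℚ` slim.
[cite: MochizukiAbsTopI2012, Ex 4.8 (i) p.58] -/
theorem ex_4_8_i_prodClass_two :
    Literature.AnabelianGeometry.AbsoluteAnabelian.AbsTopI.ConstructionDataClass.Ex_4_8_i
      ({ Base := Unit
         fld := fun _ => ℚ
         instField := fun _ => inferInstance
         instCharZero := fun _ => inferInstance
         datum := fun _ =>
           { Obj := Unit
             Hom := fun _ _ =>
               {c : AugmentedProfiniteGrp.OuterHom (G := absoluteGaloisGrp ℚ)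
                   { arith := ProfiniteGrp.of (Field.absoluteGaloisGroup ℚ × Field.absoluteGaloisGroup ℚ)
                     aug := ContinuousMonoidHom.snd _ _
                     aug_surjective := fun y => ⟨(1, y), rfl⟩ }
                   { arith := ProfiniteGrp.of (Field.absoluteGaloisGroup ℚ × Field.absoluteGaloisGroup ℚ)
                     aug := ContinuousMonoidHom.snd _ _
                     aug_surjective := fun y => ⟨(1, y), rfl⟩ } // c.IsOpen}
             IsIso := fun f => f.1.IsIso
             IsHyperbolicCurve := fun _ => True
             primes := Set.univ
             grp := fun _ =>
               { arith := ProfiniteGrp.of (Field.absoluteGaloisGroup ℚ × Field.absoluteGaloisGroup ℚ)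
                 aug := ContinuousMonoidHom.snd _ _
                 aug_surjective := fun y => ⟨(1, y), rfl⟩ }
             outerHom := fun f => f.1 }
         Mem := fun _ _ => True
         IsHyperbolicOrbicurve := fun _ _ => True
         isHyperbolicOrbicurve_of_isHyperbolicCurve := fun _ _ _ => trivial
         chainTerms := fun _ _ => Set.univ } : ConstructionDataClass.{0}) 2 :=
  ex_4_8_i_tautologicalClass 2 Unit fun _ =>
    { arith := ProfiniteGrp.of (Field.absoluteGaloisGroup ℚ × Field.absoluteGaloisGroup ℚ)
      aug := ContinuousMonoidHom.snd _ _
      aug_surjective := fun y => ⟨(1, y), rfl⟩ }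

end Literature.AnabelianGeometry.AbsoluteAnabelian.AbsTopI.ConstructionDataClass
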